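import Summits.Ventures.HSemireg.WedgeHankelSiegelIdealFamily
import Summits.Ventures.HSemireg.WedgeHankelSubstitutionShearFlagIntersections

/-!
# Venture HSemireg — THE SPIKE FAMILY LAW: for any finite family of pure powers `δ_{p_c}` (the classes `Θ^{p_c}/p_c!`) the block Hankel matrix `[H_k(δ_{p_c})]_c` has rank
# `#{i ≤ k : some window [p_c − (N−k), p_c] contains i}` (`k ≤ N`) — its column space is spanned by the unit vectors of the COVERED rows; hence the joint kernel
# `Hom(univ,k) ⊓ ⋂_c Kr(univ, w_N δ_{p_c}, k)` has codimension `C(N,k) · #covered` and IS the Siegel ideal iff the windows cover `{0, …, k}` (`k ≤ N`)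

HONEST FRAMING. Part of the Lean index of the computation cell `pub-hsemireg` (seat p10 gen 24, Sunday typer «UNIFORM-IN-n»).
Ranks of explicit `0/1` block Hankel matrices + finite-dimensional EXTERIOR ALGEBRA over a field ONLY: no variety, no cohomology theory, no sheaf, no Ext group, no semiregularity map;
nothing here says that HC / HC_CM / HC_AV holds; no Literature fact is declared or used.  Custodian versions as in `WedgeHankelSiegelIdeal` (1/3); the dictionary (`δ_p` = the class
`Θ^p/p!`, `w_N(δ_p) = E_p`) is QUOTED, never asserted.

WHAT IS IN THE TREE.  `rank_hankel1_spikeSeq_eq_min` (`WedgeHankelSpikes`: ONE spike, rank = the size of its window `min(k+1, N+1−k, p+1, N+1−p)`); gen 23 `rank_hankel1_two_spikes_visible/invisible`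
(two spikes, special positions); M4 = this seat's `WedgeHankelSiegelIdealFamily`: `hank_spike_apply`, `rank_hank_spikes_cover`, `Hom_iInf_Kr_w_eq_siegelIdeal_iff`, `finrank_Hom_iInf_Kr_w_eq_siegelIdeal_add`;
J1 `finrank_iInf_Kr_w_top_add`; K35 `mem_span_range_restrict_iff`, `finrank_span_range_restrict` (spans of sub-families of a basis); Mathlib `Matrix.rank_eq_finrank_span_cols`.
THIS FILE (namespace `Summit.Ventures.HSemireg.Wedge.HankelOuter` continued; imports M4 and K35's file):
* §413 `hank_spikes_col_eq_single` / `hank_spikes_col_eq_zero` (every column of `[H_k(δ_{p_c})]_c` is a unit vector `e_{p_c − t}` or zero), `single_mem_range_hank_spikes_col` (every covered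
  row's unit vector is a column), **`span_range_hank_spikes_col_eq`** (the column space = `span{e_i : i covered}`), and **THE SPIKE FAMILY LAW `rank_hank_spikes`:
  `rank [H_k(δ_{p_c})]_c = #{i ≤ k : ∃ c, i ≤ p_c < i + (N + 1 − k)}`** (any finite family, every field, every `N`, `k`; for `k ≤ N` the condition reads `p_c − (N−k) ≤ i ≤ p_c`).
* §414 consequences: **`finrank_Hom_iInf_Kr_w_spikes_add`** (`dim (Hom(univ,k) ⊓ ⋂_c Kr(univ, w_N δ_{p_c}, k)) + C(N,k) · #covered = C(2N,k)`),
  **`Hom_iInf_Kr_w_spikes_eq_siegelIdeal_iff`** (`= SI_k ↔ N < k ∨ every `i ≤ k` is covered`), `Hom_iInf_Kr_w_spikes_eq_siegelIdeal_of_cover` (`k ≤ N`, windows cover ⇒ `SI_k`).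
READING: for pure powers of the polarisation the joint kernel is read off a covering problem: the class `Θ^p/p!` tests exactly the rows `i` with `p − (N−k) ≤ i ≤ p`; M4's `⌈(k+1)/(N+1−k)⌉`
bound is the fewest windows of length `N + 1 − k` covering `k + 1` rows.  Nothing Ext-side.  New names only.
-/

open Module

namespace Summit.Ventures.HSemireg.Wedge.HankelOuter

open Summit.Ventures.HSemireg.Wedge Summit.Ventures.HSemireg.Wedge.Kunneth Summit.Ventures.HSemireg.Wedge.Hankel
  Summit.Ventures.HSemireg.Wedge.BasisFree Summit.Ventures.HSemireg.Wedge.HankelSiegel Summit.Ventures.HSemireg.Wedge.HankelSiegelIdeal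
  Summit.Ventures.HSemireg.Wedge.KunnethKernel Summit.Ventures.HSemireg.Wedge.HankelFrameChange Summit.Ventures.HSemireg.Wedge.Weil
  Summit.Ventures.HSemireg.Wedge.HankelPairMixing Summit.Ventures.HSemireg.Wedge.HankelPairGrading Summit.Ventures.HSemireg.Wedge.HankelSpikes

variable (K : Type*) [Field K] {N : ℕ} {ι : Type} [Fintype ι] [DecidableEq ι]

/-! ## §413. The column space of a block Hankel matrix of spikes -/

omit [Fintype ι] [DecidableEq ι] in
/-- a column `(c, t)` of `[H_k(δ_{p_c})]_c` hitting a row `i₀` (`i₀ + t = p_c`) is the unit vector `e_{i₀}`. -/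
theorem hank_spikes_col_eq_single (k : ℕ) (p : ι → ℕ) {c : ι} {t : Fin (N + 1 - k)} {i₀ : Fin (k + 1)} (h : (i₀ : ℕ) + t = p c) :
    (hank K N k (fun (_ : Unit) (c : ι) => spikeSeq K (p c))).col (c, t) = Pi.basisFun K (Unit × Fin (k + 1)) ((), i₀) := by
  funext ⟨u, i⟩
  rw [Matrix.col_apply, hank_spike_apply, Pi.basisFun_apply, Pi.single_apply]
  by_cases hi : i = i₀
  · subst hi
    rw [if_pos h, if_pos rfl]
  · rw [if_neg (fun h' => hi (Fin.ext (by omega))), if_neg (fun h' => hi (Prod.mk.inj h').2)]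

omit [Fintype ι] [DecidableEq ι] in
/-- a column `(c, t)` of `[H_k(δ_{p_c})]_c` hitting no row is zero. -/
theorem hank_spikes_col_eq_zero (k : ℕ) (p : ι → ℕ) {c : ι} {t : Fin (N + 1 - k)} (h : ∀ i : Fin (k + 1), (i : ℕ) + t ≠ p c) :
    (hank K N k (fun (_ : Unit) (c : ι) => spikeSeq K (p c))).col (c, t) = 0 := by
  funext ⟨u, i⟩
  rw [Matrix.col_apply, hank_spike_apply, Pi.zero_apply, if_neg (h i)]

omit [Fintype ι] [DecidableEq ι] in
/-- every COVERED row's unit vector is a column: `i ≤ p_c < i + (N + 1 − k)` ⇒ `e_i = column (c, p_c − i)`. -/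
theorem single_mem_range_hank_spikes_col (k : ℕ) (p : ι → ℕ) {i : Fin (k + 1)} {c : ι} (h1 : (i : ℕ) ≤ p c) (h2 : p c < (i : ℕ) + (N + 1 - k)) :
    Pi.basisFun K (Unit × Fin (k + 1)) ((), i) ∈ Set.range (hank K N k (fun (_ : Unit) (c : ι) => spikeSeq K (p c))).col := by
  have hi := i.2
  exact ⟨(c, ⟨p c - (i : ℕ), by omega⟩), hank_spikes_col_eq_single K k p (by simp only; omega)⟩

omit [Fintype ι] [DecidableEq ι] in
/-- **THE COLUMN SPACE OF `[H_k(δ_{p_c})]_c` IS `span{e_i : i covered}`**, `i` covered iff `i ≤ p_c < i + (N + 1 − k)` for some `c`. -/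
theorem span_range_hank_spikes_col_eq (k : ℕ) (p : ι → ℕ) :
    Submodule.span K (Set.range (hank K N k (fun (_ : Unit) (c : ι) => spikeSeq K (p c))).col)
      = Submodule.span K (Set.range fun r : {r : Unit × Fin (k + 1) // ∃ c, (r.2 : ℕ) ≤ p c ∧ p c < (r.2 : ℕ) + (N + 1 - k)} => Pi.basisFun K (Unit × Fin (k + 1)) r) := by
  refine le_antisymm ?_ ?_
  · rw [Submodule.span_le]
    rintro _ ⟨⟨c, t⟩, rfl⟩
    by_cases h : ∃ i₀ : Fin (k + 1), (i₀ : ℕ) + t = p c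
    · obtain ⟨i₀, hi₀⟩ := h
      have ht := t.2
      rw [hank_spikes_col_eq_single K k p hi₀]
      exact Submodule.subset_span ⟨⟨((), i₀), c, (show (i₀ : ℕ) ≤ p c by omega), (show p c < (i₀ : ℕ) + (N + 1 - k) by omega)⟩, rfl⟩
    · rw [hank_spikes_col_eq_zero K k p (fun i => (not_exists.mp h) i)]
      exact Submodule.zero_mem _
  · rw [Submodule.span_le]
    rintro _ ⟨⟨⟨u, i⟩, c, h1, h2⟩, rfl⟩
    exact Submodule.subset_span (single_mem_range_hank_spikes_col K k p h1 h2)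

omit [DecidableEq ι] in
/-- **THE SPIKE FAMILY LAW: `rank [H_k(δ_{p_c})]_c = #{i ≤ k : ∃ c, i ≤ p_c < i + (N + 1 − k)}`** — the number of rows covered by the windows of the classes (any finite family of spikes,
every field, every `N`, `k`). -/
theorem rank_hank_spikes (k : ℕ) (p : ι → ℕ) [DecidablePred fun i : Fin (k + 1) => ∃ c, (i : ℕ) ≤ p c ∧ p c < (i : ℕ) + (N + 1 - k)] :
    (hank K N k (fun (_ : Unit) (c : ι) => spikeSeq K (p c))).rank = (Finset.univ.filter fun i : Fin (k + 1) => ∃ c, (i : ℕ) ≤ p c ∧ p c < (i : ℕ) + (N + 1 - k)).card := by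
  classical
  rw [Matrix.rank_eq_finrank_span_cols, span_range_hank_spikes_col_eq, finrank_span_range_restrict]
  rw [← Finset.card_map (Equiv.punitProd (Fin (k + 1))).symm.toEmbedding]
  congr 1
  ext ⟨u, i⟩
  simp only [Finset.mem_filter, Finset.mem_univ, true_and, Finset.mem_map_equiv, Equiv.symm_symm, Equiv.punitProd_apply]

/-! ## §414. The joint kernel of a family of spikes -/

/-- **`dim (Hom(univ,k) ⊓ ⋂_c Kr(univ, w_N δ_{p_c}, k)) + C(N,k) · #covered = C(2N,k)`** (J1's joint kernel law with the spike family law). -/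
theorem finrank_Hom_iInf_Kr_w_spikes_add (k : ℕ) (p : ι → ℕ) [DecidablePred fun i : Fin (k + 1) => ∃ c, (i : ℕ) ≤ p c ∧ p c < (i : ℕ) + (N + 1 - k)] :
    finrank K ↥(Hom K (In N) (Finset.univ : Finset (In N)) k ⊓ ⨅ c, Kr K (Finset.univ : Finset (In N)) (w K N N (spikeSeq K (p c))) k)
      + N.choose k * (Finset.univ.filter fun i : Fin (k + 1) => ∃ c, (i : ℕ) ≤ p c ∧ p c < (i : ℕ) + (N + 1 - k)).card = (N + N).choose k := by
  rw [← rank_hank_spikes K k p]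
  exact finrank_iInf_Kr_w_top_add K k (fun c => spikeSeq K (p c))

/-- **THE JOINT KERNEL OF SPIKES IS THE SIEGEL IDEAL IFF THE WINDOWS COVER: `Hom(univ,k) ⊓ ⋂_c Kr(univ, w_N δ_{p_c}, k) = SI_k ↔ N < k ∨ ∀ i ≤ k, ∃ c, i ≤ p_c < i + (N + 1 − k)`.** -/
theorem Hom_iInf_Kr_w_spikes_eq_siegelIdeal_iff (k : ℕ) (p : ι → ℕ) :
    Hom K (In N) (Finset.univ : Finset (In N)) k ⊓ (⨅ c, Kr K (Finset.univ : Finset (In N)) (w K N N (spikeSeq K (p c))) k) = siegelIdeal K N k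
      ↔ N < k ∨ ∀ i : Fin (k + 1), ∃ c, (i : ℕ) ≤ p c ∧ p c < (i : ℕ) + (N + 1 - k) := by
  classical
  rw [Hom_iInf_Kr_w_eq_siegelIdeal_iff, rank_hank_spikes]
  have hcard : (Finset.univ.filter fun i : Fin (k + 1) => ∃ c, (i : ℕ) ≤ p c ∧ p c < (i : ℕ) + (N + 1 - k)).card = k + 1
      ↔ ∀ i : Fin (k + 1), ∃ c, (i : ℕ) ≤ p c ∧ p c < (i : ℕ) + (N + 1 - k) := by
    constructor
    · intro h i
      have hu := Finset.eq_univ_of_card _ (by rw [h, Fintype.card_fin])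
      have hi : i ∈ Finset.univ.filter fun i : Fin (k + 1) => ∃ c, (i : ℕ) ≤ p c ∧ p c < (i : ℕ) + (N + 1 - k) := by rw [hu]; exact Finset.mem_univ i
      exact (Finset.mem_filter.mp hi).2
    · intro h
      rw [Finset.filter_true_of_mem (fun i _ => h i), Finset.card_univ, Fintype.card_fin]
  rw [hcard]

/-- `k ≤ N` and the windows cover `{0, …, k}` ⇒ **`Hom(univ,k) ⊓ ⋂_c Kr(univ, w_N δ_{p_c}, k) = SI_k`** (M4's `rank_hank_spikes_cover` is the covering by `⌈(k+1)/(N+1−k)⌉` consecutive windows). -/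
theorem Hom_iInf_Kr_w_spikes_eq_siegelIdeal_of_cover (k : ℕ) (p : ι → ℕ) (hcov : ∀ i : Fin (k + 1), ∃ c, (i : ℕ) ≤ p c ∧ p c < (i : ℕ) + (N + 1 - k)) :
    Hom K (In N) (Finset.univ : Finset (In N)) k ⊓ (⨅ c, Kr K (Finset.univ : Finset (In N)) (w K N N (spikeSeq K (p c))) k) = siegelIdeal K N k :=
  (Hom_iInf_Kr_w_spikes_eq_siegelIdeal_iff K k p).mpr (Or.inr hcov)

end Summit.Ventures.HSemireg.Wedge.HankelOuter
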